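import Literature.IUT.LogVolume.AdelicPacketModel
import Summits.ABC.IUTFork.LanaDegrees
import HarnessLib

/-!
# L-LANA objects IV bis: "−|log(q)| computed in the usual way" IS (minus) the arithmetic degree — the volume side (N15) meets the degree side (N7) at every finite place (LANA §8.1 (a), §4.2 (c), §9.2)

Proof-only bridge (theorems, no definitions) of the abc-iut cell (seat abc-iut-c312-4, L-LANA level,
plan/LLANA-SPEC N7 ↔ N15); TAKES NO SIDE on [IUTchIII] Cor. 3.12. LANA §8.1 (a) p. 40: "We start from the
`q`-pilot BPS inside `¹'⁰HT`. The procession-normalized log-volume of the `q`-pilot object `−|log(q)| ∈ ℝ` is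
computed in the usual way"; §9.2 p. 46: "the pilot of the target `ℝ^ss` is given by the class of `{q̲_v O_v}`";
§4.2 (c) p. 26: "`deg(a) := [F:ℚ]⁻¹ log #(O_{F_v}/a O_{F_v})`", "`φ_v = deg(q̲_v)`". Gen 0 typed the degree
side (`LanaDegrees.placeDeg`, `degOfOrd`, `qPilotBad`, over Mathlib's `NumberField.FinitePlace`) and the volume
side (`LanaRss`: log-volumes of regions for a measure standing for the volume container) SEPARATELY. At a
finite place `v` of a number field `F`, with the container the completion `K_v = v.adicCompletion F` and its
normalised Haar measure `μ_v(O_v) = 1` (campaign S: `Literature.IUT.LogVolume.LocalFieldVolume`, and c312-3's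
`AdelicPacketModel`: `μ̇^log_{F_v}(y) = −ord_v(y)·log N(v)`, `mod_{F_v}(y) = ‖y‖_v`), the two sides AGREE:

* `localLogVolume_units_smul_unitBall_eq_neg_degOfOrd` — `log μ_v(y·O_v) = −[F:ℚ]·degOfOrd v (ord_v y)` for
  `y ∈ K_v^×`;
* `localLogVolume_smul_unitBall_eq_neg_placeDeg` — `log μ_v(a·O_v) = −[F:ℚ]·deg(a)` for `a ∈ F^×`
  (gen-0 `placeDeg F v a = [F:ℚ]⁻¹ · ord_v(a) · log N(v)`, via Mathlib `FinitePlace.mk v a = ‖a‖_v`).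

So LANA's `−|log(q)|` of §8.1 (a)/§9.2 (log-volume of `q·O_v`) is `−[F:ℚ]·deg(q)` = the (un-normalised)
`q`-pilot degree of §4.2 (c) with the sign LANA's "pilots are negative" convention expects (Rem. 4.1.5).
[cite: LANA2026Report, §8.1 (a) p. 40, §9.2 p. 46, §4.2 (c) p. 26] [cite: DupuyHilado2025, §2.5.5]
NOT here: the `2l`-th root `q̲_v` (lives in an extension of `K_v`; `qPilotBad = degOfOrd v (ord/2l)` records the
factor), archimedean places, any judgement.
-/

noncomputable section

namespace Summit.ABC
namespace IUTFork

open NumberField IsDedekindDomain MeasureTheory Metric Set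
open Literature.IUT.LogVolume Literature.IUT.LogVolume.CompletionModel
open scoped NNReal ENNReal Pointwise

-- `K_v` as a nontrivially normed, proper field with its Borel σ-algebra: the same LOCAL instances as
-- `Literature.IUT.LogVolume.AdelicPacketModel` (nothing is registered globally).
attribute [local instance] Literature.NumberTheory.GaloisRepresentations.Ultrametric.AdicCompletion.nontriviallyNormedField
attribute [local instance] Literature.NumberTheory.Automorphic.properSpace_adicCompletion
attribute [local instance] Literature.IUT.LogVolume.CompletionModel.measurableSpace

variable (F : Type) [Field F] [NumberField F] (v : HeightOneSpectrum (𝓞 F))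

/-- `K_v` with its Borel σ-algebra is a Borel space (local instance; plumbing). [folklore] -/
private theorem borelSpace' : BorelSpace (v.adicCompletion F) := ⟨rfl⟩

attribute [local instance] borelSpace'

/-- The log-volume of `y·O_v` is S2's `μ̇^log_{K_v}(y)` (unfolding). [cite: MochizukiAbsTopIII2015, Prop. 5.7 (i)(b) p. 138] -/
theorem localLogVolume_units_smul_unitBall (y : (v.adicCompletion F)ˣ) :
    localLogVolume (v.adicCompletion F) (y • closedBall (0 : v.adicCompletion F) 1) =
      mulLogVolume (v.adicCompletion F) y := rfl

/-- **`log μ_v(y·O_v) = −[F:ℚ] · degOfOrd v (ord_v y)`** for `y ∈ K_v^×`: the measure-level log-volume of the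
region `y·O_v` (LANA §9.2 "`{q̲_v O_v}`") is minus `[F:ℚ]` times gen-0's degree `[F:ℚ]⁻¹·ord_v(y)·log N(v)`
(§4.2 (c)). [cite: LANA2026Report, §9.2 p. 46, §4.2 (c) p. 26] -/
theorem localLogVolume_units_smul_unitBall_eq_neg_degOfOrd (y : (v.adicCompletion F)ˣ) :
    localLogVolume (v.adicCompletion F) (y • closedBall (0 : v.adicCompletion F) 1) =
      -(Module.finrank ℚ F : ℝ) * degOfOrd v (ordv F v y : ℝ) := by
  rw [localLogVolume_units_smul_unitBall, mulLogVolume_eq F v y, logNorm, degOfOrd]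
  have hF : (Module.finrank ℚ F : ℝ) ≠ 0 := finrank_pos_real.ne'
  field_simp

/-- **`log μ_v(a·O_v) = −[F:ℚ] · deg(a)`** for `a ∈ F^×` (gen-0 `placeDeg`, Mathlib `FinitePlace`): "−|log(q)|
computed in the usual way" (§8.1 (a)) for the region `q·O_v` IS the negative of `[F:ℚ]·deg(q)` (§4.2 (c)).
[cite: LANA2026Report, §8.1 (a) p. 40, §4.2 (c) p. 26] -/
theorem localLogVolume_smul_unitBall_eq_neg_placeDeg (a : F) (ha : a ≠ 0) :
    localLogVolume (v.adicCompletion F)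
        (Units.mk0 (FinitePlace.embedding v a) ((map_ne_zero _).mpr ha) • closedBall (0 : v.adicCompletion F) 1) =
      -(Module.finrank ℚ F : ℝ) * placeDeg F v a := by
  rw [localLogVolume_units_smul_unitBall, mulLogVolume_eq_log_distribHaarChar, distribHaarChar_eq_norm,
    Units.val_mk0, placeDeg, FinitePlace.mk_apply]
  have hF : (Module.finrank ℚ F : ℝ) ≠ 0 := finrank_pos_real.ne'
  field_simp

/-- Hence the `q`-region has NEGATIVE log-volume as soon as `deg(q) > 0` (e.g. `q ∈ 𝔪_v`, gen-0
`placeDeg_pos`) — LANA Rem. 4.1.5 "pilots are negative". [cite: LANA2026Report, Rem. 4.1.5 p. 24, §4.2 (c) p. 26] -/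
theorem localLogVolume_smul_unitBall_neg_of_placeDeg_pos (a : F) (ha : a ≠ 0) (hdeg : 0 < placeDeg F v a) :
    localLogVolume (v.adicCompletion F)
        (Units.mk0 (FinitePlace.embedding v a) ((map_ne_zero _).mpr ha) • closedBall (0 : v.adicCompletion F) 1) < 0 := by
  rw [localLogVolume_smul_unitBall_eq_neg_placeDeg F v a ha]
  have hF : 0 < (Module.finrank ℚ F : ℝ) := finrank_pos_real
  nlinarith

end IUTFork

end Summit.ABC

end
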